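import Summits.ResolutionOfSingularities.ResolutionOfSingularities.Theorems.HomologicalConductorNoZenoExceptionalEquation
import Summits.ResolutionOfSingularities.ResolutionOfSingularities.Theorems.AbhyankarShadowsSemivaluationShadowsQfgRankOne
import Literature.AlgebraicGeometry.Resolution.MuPTorsorLocalUniformizationRelative
import HarnessLib

/-!
# Crux `NoZenoR` (stmt-ResolutionOfSingularities-19943), slot 2 (Exh3 / ExhHigh) and slot 4's kernel:
# ABHYANKAR-PLACE INTERLACING — FACT-FREE, EVERY DIMENSION

OURS (cell res-hironaka, crux chain W4.4; lead res-L0-w44-lead-1 g10, DESK WORD 42 OBJECT 2-W).  AI-written, weaker than expert review;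
nothing here is a statement of the manuscript under review (Hironaka 2017).  SUPPORT-level, counted 0.  Def-free, FACT-FREE (the
Abhyankar-place case of relative local uniformization is PROVED in the tree: `relLocalUniformization_of_isAbhyankarPlace` = Cutkosky 2022,
Thm. 1.3 via `Cutkosky2022_Thm13_holds`; the defect dictionary `isAbhyankarPlace_top_of_transcendenceDefect_eq_zero`).

* `exists_regular_between_stages_of_relLU` — the interlacing of `Interlacing.exists_regular_between_stages_of_LU3` (2-R′, p584788) with
  the named fact `CossartPiltant2019LU3` replaced by the HYPOTHESIS `RelLocalUniformization k K O` and NO transcendence-degree clause: if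
  the `ca`-tower exhausts `O` and `O` admits relative local uniformization over `k`, every stage `T_m` lies in a regular local `R ⊆ O`
  (`Frac R = K`, `loc O R = R`) which lies in all late stages.
* `exists_regular_between_stages_of_abhyankarPlace` — the same FACT-FREE for `O` of transcendence defect `0` (an Abhyankar place), in
  EVERY dimension; `terminates_or_strictlyInterlaced_abhyankar`; and with 2-T (`ExcEquation.excEquation_pow_mem_ca`) the exceptional
  equations `exh_excEquation_of_relLU` / `exh_excEquation_abhyankar`.
* TEXT LEVEL: `beta1SharpExhaustive3_of_defectSplit : <Exh3, defect 0> → <Exh3, defect ≠ 0> → <Exh3>` (cardinal-free case split on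
  `transcendenceDefect k O hk`), so the slot-2 residual of record reads {Exh3^{Abh}, Exh3^{def}, BoundedRung3, ExhHigh, CapHigh}.

WHY (desk, CRUX-PLAN v8): a zero-dimensional `O` has residue tr.deg `0`, so defect `0` ⟺ `rat.rk O = tr.deg K` — the maximal-rational-rank
class (monomial valuations with ℚ-independent weights); for that class interlacing and exceptional equations hold fact-free in ALL dimensions.

References: S. D. Cutkosky, *Local uniformization of Abhyankar valuations*, Michigan Math. J. 71 (2022), Thm. 1.3 [`Cutkosky2022`];
H. Knaf, F.-V. Kuhlmann, Ann. Sci. ÉNS 38 (2005), Thm. 1.1 [`KnafKuhlmann2005`]; J. Novacoski, M. Spivakovsky (2014), Def. 2.20.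
-/

noncomputable section

-- single-problem summit: the doubled namespace component `ResolutionOfSingularities` is forced
set_option linter.dupNamespace false

namespace Summit.ResolutionOfSingularities.ResolutionOfSingularities.Theorems.NoZeno.Interlacing

open Summit.ResolutionOfSingularities.ResolutionOfSingularities.Theses.HomologicalConductor
open Summit.ResolutionOfSingularities.ResolutionOfSingularities.Theorems.NoZeno.Birth
open Summit.ResolutionOfSingularities.ResolutionOfSingularities.Theorems
open Summit.ResolutionOfSingularities.ResolutionOfSingularities.Theorems.NoZeno
open Summit.ResolutionOfSingularities.ResolutionOfSingularities.Theorems.NoZeno.SandwichCluster.Parasite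
open Literature.AlgebraicGeometry.Resolution IsLocalRing

variable {k K : Type} [Field k] [Field K] [Algebra k K]

/-! ## Interlacing from relative local uniformization (no transcendence-degree clause) -/

/-- **INTERLACING FROM RELATIVE LOCAL UNIFORMIZATION.**  If `O` admits relative local uniformization over `k` (`RelLocalUniformization k K O`,
Novacoski–Spivakovsky Def. 2.20, taken as a HYPOTHESIS) and the `ca`-tower along `O` exhausts `O`, then for every stage `T_m` there is a
regular local `k`-subalgebra `R ⊆ O` with `Frac R = K`, `loc O R = R`, `T_m ≤ R`, and `R ≤ T_M` for all late `M`.  Same proof as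
`exists_regular_between_stages_of_LU3` (uniformize `O` on a finitely generated model of `T_m`, then exhaustion swallows the finitely
generated regular model). [this work; cite: NovacoskiSpivakovsky2014, Def. 2.20] -/
theorem exists_regular_between_stages_of_relLU (p : ℕ) (hp : p.Prime)
    (k K : Type) [Field k] [CharP k p] [Field K] [Algebra k K] (O : ValuationSubring K) (A : Subalgebra k K)
    (hk : ∀ c : k, algebraMap k K c ∈ O) (hA : A.FG) (hfr : IsFractionRing ↥A K) (hAO : A.toSubring ≤ O.toSubring)
    (hRLU : RelLocalUniformization k K O) (hexh : ∀ x : K, x ∈ O → ∃ m : ℕ, x ∈ tower O A m) (m : ℕ) :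
    ∃ R : Subalgebra k K, IsRegularLocalRing ↥R ∧ IsFractionRing ↥R K ∧ R.toSubring ≤ O.toSubring ∧ loc O R = R ∧
      tower O A m ≤ R ∧ ∃ M₀ : ℕ, ∀ M : ℕ, M₀ ≤ M → R ≤ tower O A M := by
  classical
  haveI := hfr
  -- a finitely generated presentation `T_m = loc O B` of the stage
  have hshape : (∃ B : Subalgebra k K, B.FG ∧ B ≤ tower O A m ∧
      loc O B = tower O A m ∧ ∀ x ∈ tower O A m, ∃ b ∈ B, ∃ s ∈ B, s⁻¹ ∈ O ∧ x = b * s⁻¹) ∧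
      IsNoetherianRing ↥(tower O A m) ∧ (tower O A m).toSubring ≤ O.toSubring ∧
      ∀ s ∈ tower O A m, s⁻¹ ∈ O → s⁻¹ ∈ tower O A m :=
    StrictDrop.Birth.TowerShape.stub_towerShape p hp k K O A hk hA hfr hAO m
  obtain ⟨⟨B, hBfg, hBT, hlocB, -⟩, -, hTO, -⟩ := hshape
  obtain ⟨SB, hSB⟩ := hBfg
  obtain ⟨SA, hSA⟩ := id hA
  -- the finitely generated model `X = k[SA ∪ SB] ⊇ A ∪ B` of the stage
  set X : Subalgebra k K := Algebra.adjoin k ((SA ∪ SB : Finset K) : Set K) with hX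
  have hXfg : X.FG := ⟨SA ∪ SB, rfl⟩
  have hAX : A ≤ X := by
    rw [← hSA]
    exact Algebra.adjoin_mono fun y hy => by
      simp only [Finset.coe_union, Set.mem_union, Finset.mem_coe] at hy ⊢; exact Or.inl hy
  have hBX : B ≤ X := by
    rw [← hSB]
    exact Algebra.adjoin_mono fun y hy => by
      simp only [Finset.coe_union, Set.mem_union, Finset.mem_coe] at hy ⊢; exact Or.inr hy
  have hXO : X.toSubring ≤ O.toSubring := by
    let OA : Subalgebra k K := { O.toSubring with algebraMap_mem' := fun c => hk c }
    have hle : X ≤ OA := by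
      refine Algebra.adjoin_le fun y hy => ?_
      simp only [Finset.coe_union, Set.mem_union, Finset.mem_coe] at hy
      rcases hy with hy | hy
      · exact hAO (hSA ▸ Algebra.subset_adjoin hy : y ∈ A)
      · exact hTO (hBT (hSB ▸ Algebra.subset_adjoin hy : y ∈ B))
    exact fun x hx => hle hx
  haveI hXfr : IsFractionRing ↥X K := isFractionRing_subalgebra_of_le A X hAX
  -- relative local uniformization of `O` on `X`
  obtain ⟨A', hA'O, hXA', hA'fg, hreg⟩ := hRLU X hXfg hXfr hXO
  haveI : IsFractionRing ↥A' K := isFractionRing_subalgebra_of_le X A' hXA'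
  refine ⟨loc O A', ?_, ?_, ?_, ?_, ?_, ?_⟩
  · rw [loc_eq_locAt]
    exact (SyzygyFlattening.isRegularLocalRing_locAt_iff_atPrime O A' hA'O).mpr hreg
  · rw [loc_eq_locAt]
    exact isFractionRing_subalgebra_of_le A' _ (SyzygyFlattening.self_le_locAt O A')
  · rw [loc_eq_locAt]
    exact SyzygyFlattening.locAt_toSubring_le O hk hA'O
  · rw [loc_eq_locAt]
    exact SyzygyFlattening.locAt_locAt O A' hA'O
  · rw [← hlocB, loc_eq_locAt, loc_eq_locAt]
    exact SyzygyFlattening.locAt_mono O (hBX.trans hXA')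
  · obtain ⟨M₀, hM₀⟩ := exh_le_tower_of_fg O A hk hAO hexh A' hA'fg hA'O
    exact ⟨M₀, fun M hM => (hM₀ M hM).2⟩

/-- **TERMINATES OR STRICTLY INTERLACED (from relative local uniformization).**  An `O`-exhausting `ca`-tower, `O` admitting relative
local uniformization over `k`, either has a regular stage, or for every `m` some regular local `R ⊆ O` (`loc O R = R`) sits STRICTLY
between two stages `T_m < R < T_M`. [this work] -/
theorem terminates_or_strictlyInterlaced_of_relLU (p : ℕ) (hp : p.Prime)
    (k K : Type) [Field k] [CharP k p] [Field K] [Algebra k K] (O : ValuationSubring K) (A : Subalgebra k K)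
    (hk : ∀ c : k, algebraMap k K c ∈ O) (hA : A.FG) (hfr : IsFractionRing ↥A K) (hAO : A.toSubring ≤ O.toSubring)
    (hRLU : RelLocalUniformization k K O) (hexh : ∀ x : K, x ∈ O → ∃ m : ℕ, x ∈ tower O A m) :
    (∃ m : ℕ, IsRegularLocalRing ↥(tower O A m)) ∨
      ∀ m : ℕ, ∃ R : Subalgebra k K, IsRegularLocalRing ↥R ∧ R.toSubring ≤ O.toSubring ∧ loc O R = R ∧
        ∃ M : ℕ, m < M ∧ tower O A m < R ∧ R < tower O A M := by
  classical
  by_cases hterm : ∃ m : ℕ, IsRegularLocalRing ↥(tower O A m)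
  · exact Or.inl hterm
  push Not at hterm
  refine Or.inr fun m => ?_
  obtain ⟨R, hreg, -, hRO, hloc, hTR, M₀, hM₀⟩ :=
    exists_regular_between_stages_of_relLU p hp k K O A hk hA hfr hAO hRLU hexh m
  refine ⟨R, hreg, hRO, hloc, max M₀ (m + 1), by omega, lt_of_le_of_ne hTR ?_, lt_of_le_of_ne (hM₀ _ (le_max_left _ _)) ?_⟩
  · intro h
    exact hterm m (h ▸ hreg)
  · intro h
    exact hterm (max M₀ (m + 1)) (h ▸ hreg)

/-- **EXCEPTIONAL EQUATIONS ALONG AN EXHAUSTING TOWER (from relative local uniformization; every dimension).**  With 2-T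
(`ExcEquation.excEquation_pow_mem_ca`): either some stage is regular, or above every stage `T_m` there are `T_M ⊇ R ⊇ T_m` (`m < M`,
`R` regular) and a non-zero `g ∈ R` of positive value with `g ^ N ∈ ca(T_M)`, `N ≥ 1`. [this work] -/
theorem exh_excEquation_of_relLU (p : ℕ) (hp : p.Prime)
    (k K : Type) [Field k] [CharP k p] [Field K] [Algebra k K] (O : ValuationSubring K) (A : Subalgebra k K)
    (hk : ∀ c : k, algebraMap k K c ∈ O) (hA : A.FG) (hfr : IsFractionRing ↥A K) (hAO : A.toSubring ≤ O.toSubring)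
    (hRLU : RelLocalUniformization k K O) (hexh : ∀ x : K, x ∈ O → ∃ m : ℕ, x ∈ tower O A m) (m : ℕ) :
    (∃ M : ℕ, IsRegularLocalRing ↥(tower O A M)) ∨
      ∃ M : ℕ, m < M ∧ ∃ R : Subalgebra k K, IsRegularLocalRing ↥R ∧ tower O A m ≤ R ∧ R ≤ tower O A M ∧
        ∃ g : K, g ∈ R ∧ g ≠ 0 ∧ O.valuation g < 1 ∧ ∃ N : ℕ, 0 < N ∧ g ^ N ∈ ca (tower O A M) := by
  obtain ⟨R, hreg, hRfr, hRO, hlocR, hTR, M₀, hM⟩ :=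
    exists_regular_between_stages_of_relLU p hp k K O A hk hA hfr hAO hRLU hexh m
  have hRM : R ≤ tower O A (max M₀ (m + 1)) := hM _ (le_max_left _ _)
  rcases ExcEquation.excEquation_pow_mem_ca p hp k K O A hk hA hfr hAO hreg hRfr hRO hlocR hRM with
    h | ⟨g, hgR, hg0, hvg, N, hN, hgN⟩
  · exact Or.inl ⟨_, h⟩
  · exact Or.inr ⟨max M₀ (m + 1), lt_of_lt_of_le (Nat.lt_succ_self m) (le_max_right _ _), R, hreg, hTR, hRM,
      g, hgR, hg0, hvg, N, hN, hgN⟩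

/-! ## Abhyankar places (transcendence defect `0`): fact-free, every dimension -/

/-- `K = Frac A` for a finitely generated `k`-algebra `A` makes `K/k` a finitely generated field extension. [folklore; tree] -/
theorem fg_top_of_subalgebra (A : Subalgebra k K) (hA : A.FG) (hfr : IsFractionRing ↥A K) :
    (⊤ : IntermediateField k K).FG := by
  haveI := hfr
  haveI : Algebra.FiniteType k ↥A := A.fg_iff_finiteType.mp hA
  exact IntermediateField.fg_top_of_isFractionRing_of_finiteType k ↥A K

/-- **An Abhyankar place admits relative local uniformization (fact-free)**: for `K/k` finitely generated and `O ∋ k` of transcendence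
defect `0`. [cite: Cutkosky2022, Thm. 1.3] (tree `relLocalUniformization_of_isAbhyankarPlace` + `isAbhyankarPlace_top_of_transcendenceDefect_eq_zero`) -/
theorem relLocalUniformization_of_transcendenceDefect_eq_zero (O : ValuationSubring K) (A : Subalgebra k K)
    (hk : ∀ c : k, algebraMap k K c ∈ O) (hA : A.FG) (hfr : IsFractionRing ↥A K)
    (hD : transcendenceDefect k O hk = 0) : RelLocalUniformization k K O :=
  relLocalUniformization_of_isAbhyankarPlace (fg_top_of_subalgebra A hA hfr) O hk
    (isAbhyankarPlace_top_of_transcendenceDefect_eq_zero (fg_top_of_subalgebra A hA hfr) O hk hD)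

/-- **ABHYANKAR-PLACE INTERLACING (fact-free, every dimension).**  For `O` of transcendence defect `0` and an `O`-exhausting `ca`-tower:
every stage `T_m` lies in a regular local `R ⊆ O` (`Frac R = K`, `loc O R = R`) contained in all late stages.
[this work; cite: Cutkosky2022, Thm. 1.3] -/
theorem exists_regular_between_stages_of_abhyankarPlace (p : ℕ) (hp : p.Prime)
    (k K : Type) [Field k] [CharP k p] [Field K] [Algebra k K] (O : ValuationSubring K) (A : Subalgebra k K)
    (hk : ∀ c : k, algebraMap k K c ∈ O) (hA : A.FG) (hfr : IsFractionRing ↥A K) (hAO : A.toSubring ≤ O.toSubring)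
    (hD : transcendenceDefect k O hk = 0) (hexh : ∀ x : K, x ∈ O → ∃ m : ℕ, x ∈ tower O A m) (m : ℕ) :
    ∃ R : Subalgebra k K, IsRegularLocalRing ↥R ∧ IsFractionRing ↥R K ∧ R.toSubring ≤ O.toSubring ∧ loc O R = R ∧
      tower O A m ≤ R ∧ ∃ M₀ : ℕ, ∀ M : ℕ, M₀ ≤ M → R ≤ tower O A M :=
  exists_regular_between_stages_of_relLU p hp k K O A hk hA hfr hAO
    (relLocalUniformization_of_transcendenceDefect_eq_zero O A hk hA hfr hD) hexh m

/-- **TERMINATES OR STRICTLY INTERLACED at an Abhyankar place (fact-free, every dimension).** [this work; cite: Cutkosky2022, Thm. 1.3] -/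
theorem terminates_or_strictlyInterlaced_abhyankar (p : ℕ) (hp : p.Prime)
    (k K : Type) [Field k] [CharP k p] [Field K] [Algebra k K] (O : ValuationSubring K) (A : Subalgebra k K)
    (hk : ∀ c : k, algebraMap k K c ∈ O) (hA : A.FG) (hfr : IsFractionRing ↥A K) (hAO : A.toSubring ≤ O.toSubring)
    (hD : transcendenceDefect k O hk = 0) (hexh : ∀ x : K, x ∈ O → ∃ m : ℕ, x ∈ tower O A m) :
    (∃ m : ℕ, IsRegularLocalRing ↥(tower O A m)) ∨
      ∀ m : ℕ, ∃ R : Subalgebra k K, IsRegularLocalRing ↥R ∧ R.toSubring ≤ O.toSubring ∧ loc O R = R ∧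
        ∃ M : ℕ, m < M ∧ tower O A m < R ∧ R < tower O A M :=
  terminates_or_strictlyInterlaced_of_relLU p hp k K O A hk hA hfr hAO
    (relLocalUniformization_of_transcendenceDefect_eq_zero O A hk hA hfr hD) hexh

/-- **EXCEPTIONAL EQUATIONS at an Abhyankar place (fact-free, every dimension).** [this work; cite: Cutkosky2022, Thm. 1.3;
IyengarTakahashi2014, Thm. 5.4] -/
theorem exh_excEquation_abhyankar (p : ℕ) (hp : p.Prime)
    (k K : Type) [Field k] [CharP k p] [Field K] [Algebra k K] (O : ValuationSubring K) (A : Subalgebra k K)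
    (hk : ∀ c : k, algebraMap k K c ∈ O) (hA : A.FG) (hfr : IsFractionRing ↥A K) (hAO : A.toSubring ≤ O.toSubring)
    (hD : transcendenceDefect k O hk = 0) (hexh : ∀ x : K, x ∈ O → ∃ m : ℕ, x ∈ tower O A m) (m : ℕ) :
    (∃ M : ℕ, IsRegularLocalRing ↥(tower O A M)) ∨
      ∃ M : ℕ, m < M ∧ ∃ R : Subalgebra k K, IsRegularLocalRing ↥R ∧ tower O A m ≤ R ∧ R ≤ tower O A M ∧
        ∃ g : K, g ∈ R ∧ g ≠ 0 ∧ O.valuation g < 1 ∧ ∃ N : ℕ, 0 < N ∧ g ^ N ∈ ca (tower O A M) :=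
  exh_excEquation_of_relLU p hp k K O A hk hA hfr hAO
    (relLocalUniformization_of_transcendenceDefect_eq_zero O A hk hA hfr hD) hexh m

end Summit.ResolutionOfSingularities.ResolutionOfSingularities.Theorems.NoZeno.Interlacing


namespace Summit.ResolutionOfSingularities.ResolutionOfSingularities.Theorems.NoZeno.Beta1Trdeg3

open Summit.ResolutionOfSingularities.ResolutionOfSingularities.Theses.HomologicalConductor
open Summit.ResolutionOfSingularities.ResolutionOfSingularities.Theorems.NoZeno.Birth
open Summit.ResolutionOfSingularities.ResolutionOfSingularities.Theorems
open Summit.ResolutionOfSingularities.ResolutionOfSingularities.Theorems.NoZeno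
open Summit.ResolutionOfSingularities.ResolutionOfSingularities.Theorems.NoZeno.SandwichCluster.Parasite
open Literature.AlgebraicGeometry.Resolution IsLocalRing

/-! ## TEXT LEVEL: the defect split of `Exh3` -/

/-- **`Exh3` FROM ITS DEFECT HALVES** (`h0` = Exh3^{Abh}: transcendence defect `0`, the Abhyankar/maximal-rational-rank class where
interlacing and exceptional equations are fact-free; `h1` = Exh3^{def}: positive defect).  The two hypothesis texts are the `Exh3` text of
`…NoZenoBeta1Trdeg3` (binder `b` of `beta1RankOneSharpF_of_split`) with the ground-field binder NAMED (`hk`) and the clause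
`transcendenceDefect k O hk = 0 →` (resp. `≠ 0 →`) inserted after `Algebra.trdeg k K = 3 →`; the conclusion is `Exh3` verbatim.
[this work; pure logic] -/
theorem beta1SharpExhaustive3_of_defectSplit
    (h0 :
      PersistenceRadical → StrictDrop → ∀ p : ℕ, p.Prime → ∀ (k K : Type) [Field k] [CharP k p] [Field K]
        [Algebra k K] (O : ValuationSubring K) (A : Subalgebra k K) (hk : ∀ c : k, algebraMap k K c ∈ O),
        A.FG → IsFractionRing ↥A K → A.toSubring ≤ O.toSubring →
        (∀ O' : ValuationSubring K,
          (∀ m : ℕ, ∀ s ∈ tower O A m, s ∈ O' ∧ (s⁻¹ ∈ O' → s⁻¹ ∈ O)) → ¬ IsNoetherianRing ↥O') →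
        (∀ O' : ValuationSubring K, O < O' → ∃ m : ℕ, ∃ s ∈ tower O A m, s⁻¹ ∈ O' ∧ s⁻¹ ∉ O) →
        (∀ (k' K' : Type) [Field k'] [CharP k' p] [Field K'] [Algebra k' K'] (O' : ValuationSubring K')
          (A' : Subalgebra k' K'), (∀ c : k', algebraMap k' K' c ∈ O') → A'.FG → IsFractionRing ↥A' K' →
          A'.toSubring ≤ O'.toSubring → Algebra.trdeg k' K' < Algebra.trdeg k K →
          ∃ m : ℕ, IsRegularLocalRing ↥(tower O' A' m)) →
        (∀ m : ℕ, ∀ s ∈ tower O A m, ∃ f : Polynomial k, f ≠ 0 ∧ O.valuation (Polynomial.aeval s f) < 1) →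
        Algebra.trdeg k K = 3 → transcendenceDefect k O hk = 0 →
        (∀ O₁ : ValuationSubring K, O < O₁ → O₁ = ⊤) →
        (∀ x : K, x ∈ O → ∃ m : ℕ, x ∈ tower O A m) →
        ¬ SingularPrimeThread O A →
        ∃ m : ℕ, IsRegularLocalRing ↥(tower O A m))
    (h1 :
      PersistenceRadical → StrictDrop → ∀ p : ℕ, p.Prime → ∀ (k K : Type) [Field k] [CharP k p] [Field K]
        [Algebra k K] (O : ValuationSubring K) (A : Subalgebra k K) (hk : ∀ c : k, algebraMap k K c ∈ O),
        A.FG → IsFractionRing ↥A K → A.toSubring ≤ O.toSubring →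
        (∀ O' : ValuationSubring K,
          (∀ m : ℕ, ∀ s ∈ tower O A m, s ∈ O' ∧ (s⁻¹ ∈ O' → s⁻¹ ∈ O)) → ¬ IsNoetherianRing ↥O') →
        (∀ O' : ValuationSubring K, O < O' → ∃ m : ℕ, ∃ s ∈ tower O A m, s⁻¹ ∈ O' ∧ s⁻¹ ∉ O) →
        (∀ (k' K' : Type) [Field k'] [CharP k' p] [Field K'] [Algebra k' K'] (O' : ValuationSubring K')
          (A' : Subalgebra k' K'), (∀ c : k', algebraMap k' K' c ∈ O') → A'.FG → IsFractionRing ↥A' K' →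
          A'.toSubring ≤ O'.toSubring → Algebra.trdeg k' K' < Algebra.trdeg k K →
          ∃ m : ℕ, IsRegularLocalRing ↥(tower O' A' m)) →
        (∀ m : ℕ, ∀ s ∈ tower O A m, ∃ f : Polynomial k, f ≠ 0 ∧ O.valuation (Polynomial.aeval s f) < 1) →
        Algebra.trdeg k K = 3 → transcendenceDefect k O hk ≠ 0 →
        (∀ O₁ : ValuationSubring K, O < O₁ → O₁ = ⊤) →
        (∀ x : K, x ∈ O → ∃ m : ℕ, x ∈ tower O A m) →
        ¬ SingularPrimeThread O A →
        ∃ m : ℕ, IsRegularLocalRing ↥(tower O A m)) :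
    PersistenceRadical → StrictDrop → ∀ p : ℕ, p.Prime → ∀ (k K : Type) [Field k] [CharP k p] [Field K]
      [Algebra k K] (O : ValuationSubring K) (A : Subalgebra k K), (∀ c : k, algebraMap k K c ∈ O) →
      A.FG → IsFractionRing ↥A K → A.toSubring ≤ O.toSubring →
      (∀ O' : ValuationSubring K,
        (∀ m : ℕ, ∀ s ∈ tower O A m, s ∈ O' ∧ (s⁻¹ ∈ O' → s⁻¹ ∈ O)) → ¬ IsNoetherianRing ↥O') →
      (∀ O' : ValuationSubring K, O < O' → ∃ m : ℕ, ∃ s ∈ tower O A m, s⁻¹ ∈ O' ∧ s⁻¹ ∉ O) →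
      (∀ (k' K' : Type) [Field k'] [CharP k' p] [Field K'] [Algebra k' K'] (O' : ValuationSubring K')
        (A' : Subalgebra k' K'), (∀ c : k', algebraMap k' K' c ∈ O') → A'.FG → IsFractionRing ↥A' K' →
        A'.toSubring ≤ O'.toSubring → Algebra.trdeg k' K' < Algebra.trdeg k K →
        ∃ m : ℕ, IsRegularLocalRing ↥(tower O' A' m)) →
      (∀ m : ℕ, ∀ s ∈ tower O A m, ∃ f : Polynomial k, f ≠ 0 ∧ O.valuation (Polynomial.aeval s f) < 1) →
      Algebra.trdeg k K = 3 →
      (∀ O₁ : ValuationSubring K, O < O₁ → O₁ = ⊤) →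
      (∀ x : K, x ∈ O → ∃ m : ℕ, x ∈ tower O A m) →
      ¬ SingularPrimeThread O A →
      ∃ m : ℕ, IsRegularLocalRing ↥(tower O A m) := by
  intro hP hD p hp k K _ _ _ _ O A hk hA hfr hAO hker hmax IH hzd htr hr1 hexh hthr
  by_cases hδ : transcendenceDefect k O hk = 0
  · exact h0 hP hD p hp k K O A hk hA hfr hAO hker hmax IH hzd htr hδ hr1 hexh hthr
  · exact h1 hP hD p hp k K O A hk hA hfr hAO hker hmax IH hzd htr hδ hr1 hexh hthr

/-- **At Exh3^{Abh}'s binders the fact-free tools apply**: an `O`-exhausting tower with `O` of transcendence defect `0` either terminates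
or carries exceptional equations above every stage (`Interlacing.exh_excEquation_abhyankar`; the registry binders other than `hk`, `hA`,
`hfr`, `hAO`, the defect and the exhaustion are not used). [this work] -/
theorem exh3Abh_excEquation (p : ℕ) (hp : p.Prime)
    (k K : Type) [Field k] [CharP k p] [Field K] [Algebra k K] (O : ValuationSubring K) (A : Subalgebra k K)
    (hk : ∀ c : k, algebraMap k K c ∈ O) (hA : A.FG) (hfr : IsFractionRing ↥A K) (hAO : A.toSubring ≤ O.toSubring)
    (hD : transcendenceDefect k O hk = 0) (hexh : ∀ x : K, x ∈ O → ∃ m : ℕ, x ∈ tower O A m) :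
    (∃ M : ℕ, IsRegularLocalRing ↥(tower O A M)) ∨
      ∀ m : ℕ, ∃ M : ℕ, m < M ∧ ∃ R : Subalgebra k K, IsRegularLocalRing ↥R ∧ tower O A m ≤ R ∧ R ≤ tower O A M ∧
        ∃ g : K, g ∈ R ∧ g ≠ 0 ∧ O.valuation g < 1 ∧ ∃ N : ℕ, 0 < N ∧ g ^ N ∈ ca (tower O A M) := by
  by_cases hterm : ∃ M : ℕ, IsRegularLocalRing ↥(tower O A M)
  · exact Or.inl hterm
  · refine Or.inr fun m => ?_
    rcases Interlacing.exh_excEquation_abhyankar p hp k K O A hk hA hfr hAO hD hexh m with h | h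
    · exact absurd h hterm
    · exact h

end Summit.ResolutionOfSingularities.ResolutionOfSingularities.Theorems.NoZeno.Beta1Trdeg3

end
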